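import Literature.IUT.LogVolume.LatticeAutOrbits
import Literature.IUT.LogVolume.TensorPacketShell
import Literature.IUT.LogVolume.TensorPacketLattice
import Literature.IUT.LogVolume.LogShellTopology
import HarnessLib

/-!
# The (Ind2)-orbit of a region generates `c · log_p(R_I^×)`: the hull LOWER bound at one tensor packet
# (Weil, *Basic Number Theory* Ch. II §2; Dupuy–Hilado §4.9, §4.12)

The packet-level form of `LatticeAutOrbits.lean`, for the REAL tensor packet `V = ⊗_{ℚ_p} k_i` of the cell
(abc-iut-S1/S2/c312-3: `PacketAlgebra`, `logPacket = log_p(R_I^×)`, (Ind2) `indTwo = Aut_{ℚ_p}(V : log_p(R_I^×))`,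
hull `packetHull` = the `(R_I)^∼`-span). `HOME/skel/FORK-REAL-MODEL.md` §4 (skeleton seat, gen 6) names as
"MISSING FOR A TWO-SIDED KERNEL STATEMENT: the hull LOWER bound `hull(⋃_{g∈G₂} g·(ι(t)·O)) ⊇ p^m·hull(𝓘-lattice)`
(GL(Λ) acts transitively on primitive vectors of the ℤ_p-lattice Λ = log_p(R_I^×), so the orbit of a sublattice
not inside p^{m+1}Λ covers the primitive vectors of p^mΛ, whose span is p^mΛ) — GRANTED THAT (standard p-adic
lattice algebra, not in the tree)". PROVED here, over the tree's own objects and with `c ∈ ℚ_p` in place of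
`p^m` (`p^m` is the special case `zpow_content`):

* `exists_basisLattice_eq_logPacket`: `log_p(R_I^×)` IS the lattice of a basis of `V` (adapted bases of the
  factors `log_p(R_i^×)`, `exists_adaptedBasis`; tensor basis, `packetOf_eq_boxLattice`; rescaling,
  `boxLattice_eq_basisLattice_unitsSMul`), so (Ind2) is `Aut` of a basis lattice;
* **`smul_logPacket_subset_closure_orbit`**: if a region `M ⊆ V` contains a vector `x ∈ c·log_p(R_I^×) ∖
  (cp)·log_p(R_I^×)` ("of content exactly `c`"), then `c·log_p(R_I^×) ⊆ closure(⋃_{g ∈ Ind2} g·M)`, hence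
  (`smul_logPacket_subset_packetHull_orbit`) `⊆ hull(⋃_{g ∈ Ind2} g·M)` and
  (`packetHull_smul_logPacket_subset`) `hull(c·log_p(R_I^×)) ⊆ hull(⋃_g g·M)`;
* `packetHull_orbit_subset` (upper bound, for `M ⊆ c·log_p(R_I^×)`) and the TWO-SIDED
  **`packetHull_orbit_eq`**: `hull(⋃_{g ∈ Ind2} g·M) = hull(c·log_p(R_I^×))` for every region
  `M ⊆ c·log_p(R_I^×)` of content exactly `c`.

[cite: WeilBNT1967, Ch. II §2, Th. 1] [cite: DupuyHilado2025, §4.9, §4.12] The disputed-corpus constructions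
((Ind2), the hull) are the tree's typings [claim: Mochizuki2012, status: disputed]; nothing here takes a side on
[IUTchIII] Cor. 3.12, and nothing is said about WHICH `c` the bare Θ-region has (that, and the (Ind1)-union over
permuted summands — `⋃_σ` commutes with `g·` — is the consumer's: skeleton XXVI `PacketReal.orbit`/`thetaHull`).
PROOF-ONLY file: no new definitions, no named `Prop` facts.
-/

noncomputable section

open Set Module
open scoped Pointwise TensorProduct

namespace Literature.IUT.LogVolume

variable (p : ℕ) [Fact p.Prime]
variable {I : Type} [Fintype I] [DecidableEq I] [Nonempty I]
variable (k : I → Type) [∀ i, NontriviallyNormedField (k i)] [∀ i, NormedAlgebra ℚ_[p] (k i)]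
  [∀ i, IsUltrametricDist (k i)] [∀ i, ProperSpace (k i)]

/-! ## `log_p(R_I^×)` is the lattice of a basis of `V` -/

/-- **`log_p(R_I^×) = L_B` for a basis `B` of `V`** (tensor basis of adapted integral bases of the factors,
rescaled by the elementary divisors). [cite: WeilBNT1967, Ch. II §2, Th. 1] -/
theorem exists_basisLattice_eq_logPacket :
    ∃ (κ : Type) (_ : Fintype κ) (B : Basis κ ℚ_[p] (PacketAlgebra p k)),
      PadicModule.basisLattice p B = logPacket p k := by
  have hMo : ∀ i, IsOpen ((logUnitsAddSubgroup p (k i) : AddSubgroup (k i)) : Set (k i)) :=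
    fun i ↦ isOpen_logUnits p (k i)
  have hMc : ∀ i, IsCompact ((logUnitsAddSubgroup p (k i) : AddSubgroup (k i)) : Set (k i)) :=
    fun i ↦ isCompact_logUnits p (k i)
  choose n bZ b c hn hb hM using fun i => exists_adaptedBasis p (logUnitsAddSubgroup p (k i)) (hMo i) (hMc i)
  refine ⟨Π i, Fin (n i), inferInstance, (Basis.piTensorProduct b).unitsSMul fun κ => ∏ i, c i (κ i), ?_⟩
  rw [← PadicModule.boxLattice_eq_basisLattice_unitsSMul, logPacket_eq_packetOf,
    packetOf_eq_boxLattice p k b c _ hM]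

omit [Fintype I] [DecidableEq I] [Nonempty I] [∀ i, IsUltrametricDist (k i)] [∀ i, ProperSpace (k i)] in
/-- With such a basis, **(Ind2) IS the lattice-automorphism group of `L_B`** (definitional unfolding of
`indTwo = Aut_{ℚ_p}(V : log_p(R_I^×))`). [cite: DupuyHilado2025, §4.9] -/
theorem indTwo_eq_latticeAut {κ : Type} [Fintype κ] {B : Basis κ ℚ_[p] (PacketAlgebra p k)}
    (hB : PadicModule.basisLattice p B = logPacket p k) :
    indTwo p k = latticeAut ℚ_[p] (PadicModule.basisLattice p B).toIntSubmodule := by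
  rw [hB]; rfl

omit [Fintype I] [DecidableEq I] [Nonempty I] [∀ i, IsUltrametricDist (k i)] [∀ i, ProperSpace (k i)] in
/-- The (Ind2)-orbit of a region as a union of images: `⋃_{g ∈ Ind2} g·M = ⋃_{φ ∈ Ind2} φ(M)`.
[cite: DupuyHilado2025, §4.9] -/
theorem iUnion_indTwo_smul_eq (M : Set (PacketAlgebra p k)) :
    (⋃ g : indTwo p k, g • M) =
      ⋃ φ ∈ indTwo p k, (φ : PacketAlgebra p k ≃ₗ[ℚ_[p]] PacketAlgebra p k) '' M := by
  ext y
  rw [Set.mem_iUnion, Set.mem_iUnion₂]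
  constructor
  · rintro ⟨g, hy⟩
    rw [indTwo_smul_set] at hy
    exact ⟨g, g.2, hy⟩
  · rintro ⟨φ, hφ, hy⟩
    refine ⟨⟨φ, hφ⟩, ?_⟩
    rw [indTwo_smul_set]
    exact hy

/-! ## The lower bound: the orbit of a region of content `c` generates `c · log_p(R_I^×)` -/

/-- **Hull lower bound, additive form.** If `M` contains a vector `x ∈ c·log_p(R_I^×)` with
`x ∉ (c·p)·log_p(R_I^×)`, then `c·log_p(R_I^×) ⊆ closure(⋃_{g ∈ Ind2} g·M)`: write `x = c·x₀`; `x₀ ∈ log_p(R_I^×)`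
is PRIMITIVE (`primitive_iff_not_mem_p_smul`), its (Ind2)-orbit is the set of all primitive vectors
(transitivity), and those generate the lattice. [cite: WeilBNT1967, Ch. II §2, Th. 1] [cite: DupuyHilado2025, §4.9] -/
theorem smul_logPacket_subset_closure_orbit {M : Set (PacketAlgebra p k)} {x : PacketAlgebra p k} {c : ℚ_[p]}
    (hxM : x ∈ M) (hxc : x ∈ c • (logPacket p k : Set (PacketAlgebra p k)))
    (hxp : x ∉ (c * p) • (logPacket p k : Set (PacketAlgebra p k))) :
    c • (logPacket p k : Set (PacketAlgebra p k)) ⊆ AddSubgroup.closure (⋃ g : indTwo p k, g • M) := by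
  obtain ⟨κ, _, B, hB⟩ := exists_basisLattice_eq_logPacket p k
  rw [iUnion_indTwo_smul_eq, indTwo_eq_latticeAut p k hB, ← hB]
  rw [← hB] at hxc hxp
  obtain ⟨x₀, hx₀, rfl⟩ := Set.mem_smul_set.mp hxc
  -- `x₀` is primitive: otherwise `x₀ = p • y`, `c • x₀ = (c * p) • y`
  have hprim : x₀ ∉ (p : ℚ_[p]) • (PadicModule.basisLattice p B : Set (PacketAlgebra p k)) := by
    rintro ⟨y, hy, rfl⟩
    exact hxp (Set.mem_smul_set.mpr ⟨y, hy, mul_smul _ _ _⟩)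
  obtain ⟨i, hi⟩ := (PadicModule.primitive_iff_not_mem_p_smul p B hx₀).mpr hprim
  exact PadicModule.smul_basisLattice_subset_closure_iUnion_image p B hx₀ hi hxM

/-- **Hull lower bound** ("`hull(⋃_{g∈G₂} g·M) ⊇ c·𝓘`-lattice"): under the same hypothesis,
`c·log_p(R_I^×) ⊆ hull(⋃_{g ∈ Ind2} g·M)` — the hull is an `(R_I)^∼`-submodule, in particular an additive
subgroup containing the orbit. [cite: DupuyHilado2025, §4.12] [cite: WeilBNT1967, Ch. II §2, Th. 1] -/
theorem smul_logPacket_subset_packetHull_orbit {M : Set (PacketAlgebra p k)} {x : PacketAlgebra p k}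
    {c : ℚ_[p]} (hxM : x ∈ M) (hxc : x ∈ c • (logPacket p k : Set (PacketAlgebra p k)))
    (hxp : x ∉ (c * p) • (logPacket p k : Set (PacketAlgebra p k))) :
    c • (logPacket p k : Set (PacketAlgebra p k)) ⊆ packetHull p k (⋃ g : indTwo p k, g • M) := by
  refine (smul_logPacket_subset_closure_orbit p k hxM hxc hxp).trans ?_
  change (AddSubgroup.closure (⋃ g : indTwo p k, g • M) : Set (PacketAlgebra p k)) ⊆
    ((packetSpan p k (⋃ g : indTwo p k, g • M)).toAddSubgroup : Set (PacketAlgebra p k))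
  exact (AddSubgroup.closure_le _).mpr (subset_packetHull p k _)

/-- … hence **`hull(c·log_p(R_I^×)) ⊆ hull(⋃_{g ∈ Ind2} g·M)`** (monotonicity and idempotence of the hull).
[cite: DupuyHilado2025, §4.12] -/
theorem packetHull_smul_logPacket_subset {M : Set (PacketAlgebra p k)} {x : PacketAlgebra p k} {c : ℚ_[p]}
    (hxM : x ∈ M) (hxc : x ∈ c • (logPacket p k : Set (PacketAlgebra p k)))
    (hxp : x ∉ (c * p) • (logPacket p k : Set (PacketAlgebra p k))) :
    packetHull p k (c • (logPacket p k : Set (PacketAlgebra p k))) ⊆ packetHull p k (⋃ g : indTwo p k, g • M) := by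
  rw [← packetHull_packetHull p k (⋃ g : indTwo p k, g • M)]
  exact packetHull_mono p k (smul_logPacket_subset_packetHull_orbit p k hxM hxc hxp)

/-! ## The upper bound and the two-sided statement -/

omit [Fintype I] [DecidableEq I] [Nonempty I] [∀ i, IsUltrametricDist (k i)] [∀ i, ProperSpace (k i)] in
/-- **Upper bound**: (Ind2) maps `c·log_p(R_I^×)` onto itself, so the orbit of a region `M ⊆ c·log_p(R_I^×)` stays
inside and `hull(⋃_{g ∈ Ind2} g·M) ⊆ hull(c·log_p(R_I^×))`. [cite: DupuyHilado2025, §4.9, §4.12] -/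
theorem packetHull_orbit_subset {M : Set (PacketAlgebra p k)} {c : ℚ_[p]}
    (hM : M ⊆ c • (logPacket p k : Set (PacketAlgebra p k))) :
    packetHull p k (⋃ g : indTwo p k, g • M) ⊆ packetHull p k (c • (logPacket p k : Set (PacketAlgebra p k))) := by
  refine packetHull_mono p k (Set.iUnion_subset fun g => ?_)
  rw [indTwo_smul_set]
  refine (Set.image_mono hM).trans ?_
  rw [image_const_smul, image_logPacket_of_mem p k g.2]

/-- **Two-sided form** ("the hull of the (Ind2)·region equals `c·hull(𝓘-lattice)`"): for a region
`M ⊆ c·log_p(R_I^×)` containing a vector of content exactly `c`, `hull(⋃_{g ∈ Ind2} g·M) = hull(c·log_p(R_I^×))`.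
[cite: WeilBNT1967, Ch. II §2, Th. 1] [cite: DupuyHilado2025, §4.9, §4.12] -/
theorem packetHull_orbit_eq {M : Set (PacketAlgebra p k)} {x : PacketAlgebra p k} {c : ℚ_[p]}
    (hxM : x ∈ M) (hxp : x ∉ (c * p) • (logPacket p k : Set (PacketAlgebra p k)))
    (hM : M ⊆ c • (logPacket p k : Set (PacketAlgebra p k))) :
    packetHull p k (⋃ g : indTwo p k, g • M) = packetHull p k (c • (logPacket p k : Set (PacketAlgebra p k))) :=
  Set.Subset.antisymm (packetHull_orbit_subset p k hM)
    (packetHull_smul_logPacket_subset p k hxM (hM hxM) hxp)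

omit [Fintype I] [DecidableEq I] [Nonempty I] [∀ i, IsUltrametricDist (k i)] [∀ i, ProperSpace (k i)] in
/-- The `p^m` reading of "content": `x ∈ p^m·Λ ∖ p^{m+1}·Λ` is the hypothesis pair with `c := p^m`
(`c·p = p^{m+1}`). [cite: WeilBNT1967, Ch. II §2, Th. 2] -/
theorem zpow_content {x : PacketAlgebra p k} {m : ℤ}
    (hx : x ∈ ((p : ℚ_[p]) ^ m) • (logPacket p k : Set (PacketAlgebra p k)))
    (hx' : x ∉ ((p : ℚ_[p]) ^ (m + 1)) • (logPacket p k : Set (PacketAlgebra p k))) :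
    x ∈ ((p : ℚ_[p]) ^ m) • (logPacket p k : Set (PacketAlgebra p k)) ∧
      x ∉ ((p : ℚ_[p]) ^ m * p) • (logPacket p k : Set (PacketAlgebra p k)) := by
  refine ⟨hx, ?_⟩
  rwa [← zpow_add_one₀ (Nat.cast_ne_zero.mpr (Fact.out : p.Prime).ne_zero)]

/-- **The `p^m` form of the two-sided statement**: for `M ⊆ p^m·log_p(R_I^×)` containing a vector outside
`p^{m+1}·log_p(R_I^×)`, `hull(⋃_{g ∈ Ind2} g·M) = hull(p^m·log_p(R_I^×))`.
[cite: WeilBNT1967, Ch. II §2, Th. 2] [cite: DupuyHilado2025, §4.9, §4.12] -/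
theorem packetHull_orbit_eq_zpow {M : Set (PacketAlgebra p k)} {x : PacketAlgebra p k} {m : ℤ} (hxM : x ∈ M)
    (hx' : x ∉ ((p : ℚ_[p]) ^ (m + 1)) • (logPacket p k : Set (PacketAlgebra p k)))
    (hM : M ⊆ ((p : ℚ_[p]) ^ m) • (logPacket p k : Set (PacketAlgebra p k))) :
    packetHull p k (⋃ g : indTwo p k, g • M) =
      packetHull p k (((p : ℚ_[p]) ^ m) • (logPacket p k : Set (PacketAlgebra p k))) :=
  packetHull_orbit_eq p k hxM (zpow_content p k (hM hxM) hx').2 hM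

end Literature.IUT.LogVolume

end
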